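import Mathlib
import Summits.KontsevichZagierPeriods.Zeta5Search.CellBridgeDischarge
import Summits.KontsevichZagierPeriods.Zeta5Search.WedgeDictionaryKernelCellsStar12
import Summits.KontsevichZagierPeriods.Zeta5Search.WedgeDictionaryKernelCellsStar17
import Summits.KontsevichZagierPeriods.Zeta5Search.WedgeDictionaryKernelCellsStar27
import Summits.KontsevichZagierPeriods.Zeta5Search.WedgeDictionaryKernelTransport
import HarnessLib

/-!
# The cellular STAR relations for the native slot pairs `17`, `27`, `12` hold at EVERY convergent configuration
# (cell `pub-zeta5`, seat ct-1 g23)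

HONEST FRAMING: systematic search; no irrationality claim unless certified.  Identities among Brown–Zudilin's absolutely convergent
cellular integrals `I(a)` (arXiv:2210.03391, (1), (8)/(10), (16)); no integral is evaluated, nothing about `ζ(5)`; no `def`, no node.

gen-1 g21's NATIVE kernel cells `KernelCells.cellStar_native_12/17/27` (three family kernels on ONE contour, F1 + F2 — tree theorems)
prove the STAR three-term relation `κ·I(a) − fan_k·I(a − s_k) + fan_i·I(a − s_i) = 0` for SYMBOLIC `a` under: convergence of the
three members and a COMMON rational chamber point of the double Barnes integral (16).  The `@[conjecture]` node `CellStar`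
(`cellStar_holds`, ct-1 g17) packages them on the HALF BOX only (`RegionHyp` at the three members; the atlas dispatchers need it).
This file removes the chamber condition by ct-1 g18's TRANSLATION ARGUMENT (`CellBridgeDischarge`): along `a ↦ a + n·𝟙` the three
members converge and share the chamber point `(3n/4, 3n/4)` for all large `n`, the STAR coefficients become explicit polynomials of
degree `≤ 2` in `n`, `n ↦ I(x + n·𝟙)` is a moment sequence (`isMoment_cellularIntegral_add`), and a real linear combination of moment
sequences vanishing for all large `n` vanishes at `n = 0` (`lincomb_eq_zero_of_eventually`, after division by `(n+1)(n+2)(n+3)`).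

* `threeTerm_of_translates` — the moment step for THREE convergent points and quadratic coefficient polynomials;
* `starKappa_translate`, `fanCoeff_one/two/seven_translate`; `star17/27/12_translate` — the native cells at `a + n·𝟙`;
* **`cellStar_wide_17`, `cellStar_wide_27`, `cellStar_wide_12`** (and the swapped orientations `_71`, `_72`, `_21`) — the STAR
  relation at `(a; i, k)` for the three native pairs WHENEVER `a`, `a − s_k`, `a − s_i` CONVERGE (no half box, no chamber).
Use: the cellular half of the STAR steps of the induction for the off-half-box residual of `wedgeDictionaryFull`
(`HOME/ct-1/g22/WIDE-RESIDUAL.md` §5 (a); ct-1 g23, INBOX l.9031); the dictionary half is ct-1 g22's `dictStar_wide`.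
-/

noncomputable section

namespace Summit.KontsevichZagierPeriods.Zeta5Search.CellStarWide

open MeasureTheory Set Filter Finset
open Literature.NumberTheory.Irrationality.BrownZudilin2022
open Summit.KontsevichZagierPeriods.Zeta5Search.WedgeDictionary
open Summit.KontsevichZagierPeriods.Zeta5Search.WedgeDictionary.KernelCells (cellStar_native_12 cellStar_native_17
  cellStar_native_27 cellStar_swap)
open Summit.KontsevichZagierPeriods.Zeta5Search.WedgeDictionary.Kernel (ChamberQ)
open Summit.KontsevichZagierPeriods.Zeta5Search.MomentSequences
open Summit.KontsevichZagierPeriods.Zeta5Search.InvarianceGroup (isMoment_cellularIntegral_add)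
open Summit.KontsevichZagierPeriods.Zeta5Search.AmpleGroupInvariance (bOfA_add_const shiftB)
open Summit.KontsevichZagierPeriods.Zeta5Search.CellBridgeDischarge (lincomb_eq_zero_of_eventually converges_translate
  coord_abs_le chamberQ_vec)
open Summit.KontsevichZagierPeriods.Zeta5Search.CellularCubicalSubstitution (cellularIntegral_eq_cubicalIntegral_holds)
open Summit.KontsevichZagierPeriods.Zeta5Search.CubicalSubstitution (cubicalIntegral_eq_Jintegral_holds)
open Summit.KontsevichZagierPeriods.Zeta5Search.BarnesDouble (barnes_double_holds)

/-! ## 1. The moment step for three points and quadratic coefficients -/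

/-- **Three convergent points, quadratic coefficients**: if `Σ_m (A_m n² + B_m n + C_m)·I(x_m + n·𝟙) = 0` for all `n ≥ N₀`, then
`Σ_m C_m·I(x_m) = 0` (the relation at `n = 0`).  Division by `(n+1)(n+2)(n+3)`, Lagrange interpolation of each quadratic at
`−1, −2, −3`, and ct-1 g18's `lincomb_eq_zero_of_eventually` for the nine moment sequences `I(x_m + n·𝟙)/(n+i+1)`. [folklore] -/
theorem threeTerm_of_translates (x : Fin 3 → (Fin 8 → ℤ)) (hx : ∀ m, Converges (x m)) (A B C : Fin 3 → ℝ) {N₀ : ℕ}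
    (h : ∀ n : ℕ, N₀ ≤ n →
      ∑ m, (A m * (n : ℝ) ^ 2 + B m * (n : ℝ) + C m) * cellularIntegral (fun i => x m i + (n : ℤ)) = 0) :
    ∑ m, C m * cellularIntegral (x m) = 0 := by
  set M : Fin 3 → ℕ → ℝ := fun m n => cellularIntegral (fun i => x m i + (n : ℤ)) with hM
  have hMall : ∀ m : Fin 3, IsMoment (M m) := fun m => by
    simpa [hM] using isMoment_cellularIntegral_add (hx m)
  set u : Fin 3 → ℕ → ℝ := fun i n => ((n + (i : ℕ)).factorial : ℝ) / (n + ((i : ℕ) + 1)).factorial with hu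
  have huM : ∀ i : Fin 3, IsMoment (u i) := fun i => IsMoment.factorialRatio (by omega)
  have hu_eq : ∀ (i : Fin 3) (n : ℕ), u i n = 1 / ((n : ℝ) + (i : ℕ) + 1) := by
    intro i n
    simp only [hu]
    rw [show n + ((i : ℕ) + 1) = (n + (i : ℕ)) + 1 by ring, Nat.factorial_succ]
    have hf : ((n + (i : ℕ)).factorial : ℝ) ≠ 0 := by positivity
    push_cast
    field_simp
  set β : Fin 3 → ℝ → ℝ := fun m t => A m * t ^ 2 + B m * t + C m with hβ
  -- Lagrange weights at the nodes `-1, -2, -3` for the denominator `(n+1)(n+2)(n+3)`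
  set L : Fin 3 → ℝ := ![1 / 2, -1, 1 / 2] with hL
  set c : Fin 3 × Fin 3 → ℝ := fun ki => β ki.1 (-((ki.2 : ℕ) + 1 : ℝ)) * L ki.2 with hc
  set mm : Fin 3 × Fin 3 → ℕ → ℝ := fun ki n => u ki.2 n * M ki.1 n with hmm
  have hm_moment : ∀ ki ∈ (Finset.univ : Finset (Fin 3 × Fin 3)), IsMoment (mm ki) :=
    fun ki _ => (huM ki.2).mul (hMall ki.1)
  have key1 : ∀ (k : Fin 3) (n : ℕ),
      ∑ i : Fin 3, c (k, i) * u i n = β k n / (((n : ℝ) + 1) * ((n : ℝ) + 2) * ((n : ℝ) + 3)) := by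
    intro k n
    have h1 : ((n : ℝ) + 1) ≠ 0 := (by positivity); have h2 : ((n : ℝ) + 2) ≠ 0 := (by positivity)
    have h3 : ((n : ℝ) + 3) ≠ 0 := (by positivity); have h1' : ((n : ℝ) + 0 + 1) ≠ 0 := (by positivity)
    have h2' : ((n : ℝ) + 1 + 1) ≠ 0 := (by positivity); have h3' : ((n : ℝ) + 2 + 1) ≠ 0 := (by positivity)
    simp only [Fin.sum_univ_three, hc, hu_eq, hL, hβ, Matrix.cons_val, Fin.isValue, Fin.val_zero, Fin.val_one, Fin.val_two,
      Nat.cast_zero, Nat.cast_one, Nat.cast_ofNat]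
    field_simp
    ring
  have key : ∀ n : ℕ, ∑ ki, c ki * mm ki n =
      (∑ k, β k n * M k n) / (((n : ℝ) + 1) * ((n : ℝ) + 2) * ((n : ℝ) + 3)) := by
    intro n
    rw [Fintype.sum_prod_type, Finset.sum_div]
    refine Finset.sum_congr rfl fun k _ => ?_
    have hk : ∑ i : Fin 3, c (k, i) * mm (k, i) n = (∑ i : Fin 3, c (k, i) * u i n) * M k n := by
      rw [Finset.sum_mul]
      refine Finset.sum_congr rfl fun i _ => ?_
      simp only [hmm]
      ring
    rw [hk, key1 k n]
    ring
  have hnum : ∀ n : ℕ, N₀ ≤ n → ∑ k, β k n * M k n = 0 := by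
    intro n hn
    have h' := h n hn
    simpa [hβ, hM] using h'
  have hzero : ∀ n : ℕ, N₀ ≤ n → ∑ ki, c ki * mm ki n = 0 := by
    intro n hn
    rw [key n, hnum n hn, zero_div]
  have h0 := lincomb_eq_zero_of_eventually Finset.univ c mm hm_moment hzero
  rw [key 0, div_eq_zero_iff] at h0
  have hden : (((0 : ℕ) : ℝ) + 1) * (((0 : ℕ) : ℝ) + 2) * (((0 : ℕ) : ℝ) + 3) ≠ 0 := by norm_num
  have h00 : ∑ k, β k ((0 : ℕ) : ℝ) * M k 0 = 0 := h0.resolve_right hden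
  simp only [hβ, hM, Nat.cast_zero] at h00
  simpa using h00

/-! ## 2. The STAR cluster and its coefficients along `𝟙` -/

/-- `(a + n·𝟙) − s_k = (a − s_k) + n·𝟙`. [folklore] -/
theorem translate_add_slotDown (a : Fin 8 → ℤ) (k : ℕ) (n : ℕ) :
    (fun i => a i + (n : ℤ)) + slotDown k = fun i => (a + slotDown k) i + (n : ℤ) := by
  funext i; simp only [Pi.add_apply]; ring

/-- The STAR apex coefficient along `𝟙`: `κ(b(a + n·𝟙); i, k) = (b_i − b_k)(b₀ + 1 − b_i − b_k + n)` (`1 ≤ i, k ≤ 7`). [folklore] -/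
theorem starKappa_translate (a : Fin 8 → ℤ) (n : ℕ) {i k : ℕ} (hi : 1 ≤ i ∧ i ≤ 7) (hk : 1 ≤ k ∧ k ≤ 7) :
    starKappa (bOfA (fun j => a j + (n : ℤ))) i k =
      (bOfA a i - bOfA a k) * (bOfA a 0 + 1 - bOfA a i - bOfA a k + n) := by
  have hi0 : i ≠ 0 := by omega
  have hk0 : k ≠ 0 := by omega
  unfold starKappa
  rw [bOfA_add_const]
  simp only [shiftB, hi0, hk0, hi.2, hk.2, ↓reduceIte]
  ring

/-- `fan₁(b(a + n·𝟙)) = (b₀ + 1 − b₁ − b₆ + n)(b₀ + 1 − b₁ − b₇ + n)`. [folklore] -/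
theorem fanCoeff_one_translate (a : Fin 8 → ℤ) (n : ℕ) :
    fanCoeff (bOfA (fun j => a j + (n : ℤ))) 1 =
      (bOfA a 0 + 1 - bOfA a 1 - bOfA a 6 + n) * (bOfA a 0 + 1 - bOfA a 1 - bOfA a 7 + n) := by
  rw [bOfA_add_const]; simp [fanCoeff, chiOf, nonEdgePartners, shiftB]; ring

/-- `fan₂(b(a + n·𝟙)) = (b₂ + n)(b₀ + 1 − b₂ − b₇ + n)`. [folklore] -/
theorem fanCoeff_two_translate (a : Fin 8 → ℤ) (n : ℕ) :
    fanCoeff (bOfA (fun j => a j + (n : ℤ))) 2 = (bOfA a 2 + n) * (bOfA a 0 + 1 - bOfA a 2 - bOfA a 7 + n) := by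
  unfold fanCoeff chiOf nonEdgePartners
  rw [bOfA_add_const]
  simp only [shiftB, List.map, List.prod_cons, List.prod_nil, or_false, ↓reduceIte, Nat.reduceEqDiff, Nat.reduceLeDiff]
  ring

/-- `fan₇(b(a + n·𝟙)) = (b₀ + 1 − b₇ − b₁ + n)(b₀ + 1 − b₇ − b₂ + n)`. [folklore] -/
theorem fanCoeff_seven_translate (a : Fin 8 → ℤ) (n : ℕ) :
    fanCoeff (bOfA (fun j => a j + (n : ℤ))) 7 =
      (bOfA a 0 + 1 - bOfA a 7 - bOfA a 1 + n) * (bOfA a 0 + 1 - bOfA a 7 - bOfA a 2 + n) := by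
  rw [bOfA_add_const]; simp [fanCoeff, chiOf, nonEdgePartners, shiftB]; ring

/-! ## 3. The native cells at the translates -/

/-- The letters of `a + n·𝟙`. [folklore] -/
theorem pOf_translate (a : Fin 8 → ℤ) (n : ℕ) :
    pOf (fun i => a i + (n : ℤ)) = ![a 4 + a 5 - a 7 + n, a 1 + a 2 - a 3 + a 5 - a 7 + n, a 5 + n,
      a 1 + a 2 + a 5 - a 7 + 2 * n, a 6 + n, a 2 + a 5 - a 7 + n, a 0 + a 1 - a 3 + a 5 - a 7 + n] := by
  ext j; fin_cases j <;> (simp [pOf]; try ring)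

/-- The `q`-letters of `a + n·𝟙`. [folklore] -/
theorem qOf_translate (a : Fin 8 → ℤ) (n : ℕ) :
    qOf (fun i => a i + (n : ℤ)) = ![a 3 + n, a 4 + n, a 0 - a 2 + a 4 + n, a 0 + n, a 1 + n] := by
  ext j; fin_cases j <;> (simp [qOf]; try ring)

/-- The letters of `(a + n·𝟙) − s₇`. [folklore] -/
theorem pOf_translate_slotDown7 (a : Fin 8 → ℤ) (n : ℕ) :
    pOf ((fun i => a i + (n : ℤ)) + slotDown 7) = ![a 4 + a 5 - a 7 + n, a 1 + a 2 - a 3 + a 5 - a 7 + n, a 5 + n,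
      a 1 + a 2 + a 5 - a 7 + 2 * n, a 6 + 1 + n, a 2 + a 5 - a 7 + n, a 0 + a 1 - a 3 + a 5 - a 7 + n] := by
  ext j; fin_cases j <;> simp only [pOf, Pi.add_apply] <;> simp [slotDown] <;> ring

/-- The `q`-letters of `(a + n·𝟙) − s₇`. [folklore] -/
theorem qOf_translate_slotDown7 (a : Fin 8 → ℤ) (n : ℕ) :
    qOf ((fun i => a i + (n : ℤ)) + slotDown 7) = ![a 3 + n, a 4 + n, a 0 - a 2 + a 4 + n, a 0 + n, a 1 + n] := by
  ext j; fin_cases j <;> simp only [qOf, Pi.add_apply] <;> (simp [slotDown]; try ring)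

/-- The letters of `(a + n·𝟙) − s₁`. [folklore] -/
theorem pOf_translate_slotDown1 (a : Fin 8 → ℤ) (n : ℕ) :
    pOf ((fun i => a i + (n : ℤ)) + slotDown 1) = ![a 4 + a 5 - a 7 + n, a 1 + a 2 - a 3 + a 5 - a 7 + n, a 5 + n,
      a 1 + a 2 + a 5 - a 7 + 2 * n, a 6 + n, a 2 + a 5 - a 7 + n, a 0 + a 1 - a 3 + a 5 - a 7 + 1 + n] := by
  ext j; fin_cases j <;> simp only [pOf, Pi.add_apply] <;> simp [slotDown] <;> ring

/-- The `q`-letters of `(a + n·𝟙) − s₁`. [folklore] -/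
theorem qOf_translate_slotDown1 (a : Fin 8 → ℤ) (n : ℕ) :
    qOf ((fun i => a i + (n : ℤ)) + slotDown 1) = ![a 3 + n, a 4 + n, a 0 - a 2 + a 4 + 1 + n, a 0 + 1 + n, a 1 + n] := by
  ext j; fin_cases j <;> simp only [qOf, Pi.add_apply] <;> simp [slotDown] <;> ring

/-- The letters of `(a + n·𝟙) − s₂`. [folklore] -/
theorem pOf_translate_slotDown2 (a : Fin 8 → ℤ) (n : ℕ) :
    pOf ((fun i => a i + (n : ℤ)) + slotDown 2) = ![a 4 + a 5 - a 7 + n, a 1 + a 2 - a 3 + a 5 - a 7 + n, a 5 + n,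
      a 1 + a 2 + a 5 - a 7 + 2 * n, a 6 + n, a 2 + a 5 - a 7 + 1 + n, a 0 + a 1 - a 3 + a 5 - a 7 + n] := by
  ext j; fin_cases j <;> simp only [pOf, Pi.add_apply] <;> simp [slotDown] <;> ring

/-- The `q`-letters of `(a + n·𝟙) − s₂`. [folklore] -/
theorem qOf_translate_slotDown2 (a : Fin 8 → ℤ) (n : ℕ) :
    qOf ((fun i => a i + (n : ℤ)) + slotDown 2) = ![a 3 + n, a 4 + n, a 0 - a 2 + a 4 + n, a 0 + 1 + n, a 1 - 1 + n] := by
  ext j; fin_cases j <;> simp only [qOf, Pi.add_apply] <;> simp [slotDown] <;> ring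

/-- The common chamber point `(3n/4, 3n/4)` of the translated STAR members, for `n ≥ 40·Σ|a_i| + 8`. [folklore] -/
theorem chamber_translate (a : Fin 8 → ℤ) (n : ℕ) (hn : 40 * (∑ j : Fin 8, (a j).natAbs) + 8 ≤ n) :
    ChamberQ (pOf (fun i => a i + (n : ℤ))) (qOf (fun i => a i + (n : ℤ))) (3 * n / 4) (3 * n / 4) ∧
      ChamberQ (pOf ((fun i => a i + (n : ℤ)) + slotDown 7)) (qOf ((fun i => a i + (n : ℤ)) + slotDown 7))
        (3 * n / 4) (3 * n / 4) ∧
      ChamberQ (pOf ((fun i => a i + (n : ℤ)) + slotDown 1)) (qOf ((fun i => a i + (n : ℤ)) + slotDown 1))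
        (3 * n / 4) (3 * n / 4) ∧
      ChamberQ (pOf ((fun i => a i + (n : ℤ)) + slotDown 2)) (qOf ((fun i => a i + (n : ℤ)) + slotDown 2))
        (3 * n / 4) (3 * n / 4) := by
  obtain ⟨u0, l0⟩ := coord_abs_le a 0; obtain ⟨u1, l1⟩ := coord_abs_le a 1
  obtain ⟨u2, l2⟩ := coord_abs_le a 2; obtain ⟨u3, l3⟩ := coord_abs_le a 3
  obtain ⟨u4, l4⟩ := coord_abs_le a 4; obtain ⟨u5, l5⟩ := coord_abs_le a 5
  obtain ⟨u6, l6⟩ := coord_abs_le a 6; obtain ⟨u7, l7⟩ := coord_abs_le a 7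
  obtain ⟨K, hK⟩ : ∃ K : ℕ, K = ∑ j : Fin 8, (a j).natAbs := ⟨_, rfl⟩
  rw [← hK] at u0 l0 u1 l1 u2 l2 u3 l3 u4 l4 u5 l5 u6 l6 u7 l7 hn
  have hKn : (40 : ℚ) * K + 8 ≤ n := by exact_mod_cast hn
  have hK0 : (0 : ℚ) ≤ K := by positivity
  refine ⟨?_, ?_, ?_, ?_⟩
  · rw [pOf_translate, qOf_translate]
    refine chamberQ_vec ?_ ?_ ?_ ?_ ?_ ?_ ?_ ?_ ?_ <;> push_cast <;> linarith
  · rw [pOf_translate_slotDown7, qOf_translate_slotDown7]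
    refine chamberQ_vec ?_ ?_ ?_ ?_ ?_ ?_ ?_ ?_ ?_ <;> push_cast <;> linarith
  · rw [pOf_translate_slotDown1, qOf_translate_slotDown1]
    refine chamberQ_vec ?_ ?_ ?_ ?_ ?_ ?_ ?_ ?_ ?_ <;> push_cast <;> linarith
  · rw [pOf_translate_slotDown2, qOf_translate_slotDown2]
    refine chamberQ_vec ?_ ?_ ?_ ?_ ?_ ?_ ?_ ?_ ?_ <;> push_cast <;> linarith

/-- **The native cell `17` at the translates**: for `n ≥ 40·Σ|a_i| + 8` and the three translated members convergent,
`κ·I(a+n𝟙) − fan₇·I(a−s₇+n𝟙) + fan₁·I(a−s₁+n𝟙) = 0` with the coefficients at `b(a + n·𝟙)`. [folklore] -/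
theorem star17_translate (a : Fin 8 → ℤ) (n : ℕ) (hn : 40 * (∑ j : Fin 8, (a j).natAbs) + 8 ≤ n)
    (hc0 : Converges (fun i => a i + (n : ℤ))) (hc1 : Converges (fun i => (a + slotDown 7) i + (n : ℤ)))
    (hc2 : Converges (fun i => (a + slotDown 1) i + (n : ℤ))) :
    ((starKappa (bOfA (fun i => a i + (n : ℤ))) 1 7 : ℚ) : ℝ) * cellularIntegral (fun i => a i + (n : ℤ)) +
      ((-fanCoeff (bOfA (fun i => a i + (n : ℤ))) 7 : ℚ) : ℝ) * cellularIntegral (fun i => (a + slotDown 7) i + (n : ℤ)) +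
      ((fanCoeff (bOfA (fun i => a i + (n : ℤ))) 1 : ℚ) : ℝ) * cellularIntegral (fun i => (a + slotDown 1) i + (n : ℤ)) = 0 := by
  obtain ⟨h0, h7, h1, -⟩ := chamber_translate a n hn
  have hc1' : Converges ((fun i => a i + (n : ℤ)) + slotDown 7) := by rw [translate_add_slotDown]; exact hc1
  have hc2' : Converges ((fun i => a i + (n : ℤ)) + slotDown 1) := by rw [translate_add_slotDown]; exact hc2
  have key := cellStar_native_17 cellularIntegral_eq_cubicalIntegral_holds cubicalIntegral_eq_Jintegral_holds
    barnes_double_holds (fun i => a i + (n : ℤ)) (3 * n / 4) (3 * n / 4) hc0 hc1' hc2' h0 h7 h1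
  unfold ThreeTermRel at key
  rw [translate_add_slotDown, translate_add_slotDown] at key
  exact key

/-- **The native cell `27` at the translates.** [folklore] -/
theorem star27_translate (a : Fin 8 → ℤ) (n : ℕ) (hn : 40 * (∑ j : Fin 8, (a j).natAbs) + 8 ≤ n)
    (hc0 : Converges (fun i => a i + (n : ℤ))) (hc1 : Converges (fun i => (a + slotDown 7) i + (n : ℤ)))
    (hc2 : Converges (fun i => (a + slotDown 2) i + (n : ℤ))) :
    ((starKappa (bOfA (fun i => a i + (n : ℤ))) 2 7 : ℚ) : ℝ) * cellularIntegral (fun i => a i + (n : ℤ)) +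
      ((-fanCoeff (bOfA (fun i => a i + (n : ℤ))) 7 : ℚ) : ℝ) * cellularIntegral (fun i => (a + slotDown 7) i + (n : ℤ)) +
      ((fanCoeff (bOfA (fun i => a i + (n : ℤ))) 2 : ℚ) : ℝ) * cellularIntegral (fun i => (a + slotDown 2) i + (n : ℤ)) = 0 := by
  obtain ⟨h0, h7, -, h2⟩ := chamber_translate a n hn
  have hc1' : Converges ((fun i => a i + (n : ℤ)) + slotDown 7) := by rw [translate_add_slotDown]; exact hc1
  have hc2' : Converges ((fun i => a i + (n : ℤ)) + slotDown 2) := by rw [translate_add_slotDown]; exact hc2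
  have key := cellStar_native_27 cellularIntegral_eq_cubicalIntegral_holds cubicalIntegral_eq_Jintegral_holds
    barnes_double_holds (fun i => a i + (n : ℤ)) (3 * n / 4) (3 * n / 4) hc0 hc1' hc2' h0 h7 h2
  unfold ThreeTermRel at key
  rw [translate_add_slotDown, translate_add_slotDown] at key
  exact key

/-- **The native cell `12` at the translates.** [folklore] -/
theorem star12_translate (a : Fin 8 → ℤ) (n : ℕ) (hn : 40 * (∑ j : Fin 8, (a j).natAbs) + 8 ≤ n)
    (hc0 : Converges (fun i => a i + (n : ℤ))) (hc1 : Converges (fun i => (a + slotDown 2) i + (n : ℤ)))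
    (hc2 : Converges (fun i => (a + slotDown 1) i + (n : ℤ))) :
    ((starKappa (bOfA (fun i => a i + (n : ℤ))) 1 2 : ℚ) : ℝ) * cellularIntegral (fun i => a i + (n : ℤ)) +
      ((-fanCoeff (bOfA (fun i => a i + (n : ℤ))) 2 : ℚ) : ℝ) * cellularIntegral (fun i => (a + slotDown 2) i + (n : ℤ)) +
      ((fanCoeff (bOfA (fun i => a i + (n : ℤ))) 1 : ℚ) : ℝ) * cellularIntegral (fun i => (a + slotDown 1) i + (n : ℤ)) = 0 := by
  obtain ⟨h0, -, h1, h2⟩ := chamber_translate a n hn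
  have hc1' : Converges ((fun i => a i + (n : ℤ)) + slotDown 2) := by rw [translate_add_slotDown]; exact hc1
  have hc2' : Converges ((fun i => a i + (n : ℤ)) + slotDown 1) := by rw [translate_add_slotDown]; exact hc2
  have key := cellStar_native_12 cellularIntegral_eq_cubicalIntegral_holds cubicalIntegral_eq_Jintegral_holds
    barnes_double_holds (fun i => a i + (n : ℤ)) (3 * n / 4) (3 * n / 4) hc0 hc1' hc2' h0 h2 h1
  unfold ThreeTermRel at key
  rw [translate_add_slotDown, translate_add_slotDown] at key
  exact key

/-! ## 4. The STAR relations at every convergent configuration -/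

/-- **Cellular STAR at the pair `(1,7)`, every convergent configuration**: if `a`, `a − s₇`, `a − s₁` converge, then
`κ(P;1,7)·I(a) − fan₇(P)·I(a − s₇) + fan₁(P)·I(a − s₁) = 0`, `P = b(a)`. [folklore] -/
theorem cellStar_wide_17 (a : Fin 8 → ℤ) (hc0 : Converges a) (hc1 : Converges (a + slotDown 7))
    (hc2 : Converges (a + slotDown 1)) :
    ThreeTermRel (starKappa (bOfA a) 1 7) (-fanCoeff (bOfA a) 7) (fanCoeff (bOfA a) 1) a (a + slotDown 7) (a + slotDown 1) := by
  -- the three quadratics in `n`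
  have key := threeTerm_of_translates ![a, a + slotDown 7, a + slotDown 1]
    (by intro m; fin_cases m <;> assumption)
    ![0, -1, 1]
    ![((bOfA a 1 : ℝ) - bOfA a 7),
      -((2 * (bOfA a 0 : ℝ) + 2 - 2 * bOfA a 7 - bOfA a 1 - bOfA a 2)),
      (2 * (bOfA a 0 : ℝ) + 2 - 2 * bOfA a 1 - bOfA a 6 - bOfA a 7)]
    ![((bOfA a 1 : ℝ) - bOfA a 7) * ((bOfA a 0 : ℝ) + 1 - bOfA a 1 - bOfA a 7),
      -(((bOfA a 0 : ℝ) + 1 - bOfA a 7 - bOfA a 1) * ((bOfA a 0 : ℝ) + 1 - bOfA a 7 - bOfA a 2)),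
      ((bOfA a 0 : ℝ) + 1 - bOfA a 1 - bOfA a 6) * ((bOfA a 0 : ℝ) + 1 - bOfA a 1 - bOfA a 7)]
    (N₀ := 40 * (∑ j : Fin 8, (a j).natAbs) + 8 + ((hList a).map Int.natAbs).sum +
      ((hList (a + slotDown 7)).map Int.natAbs).sum + ((hList (a + slotDown 1)).map Int.natAbs).sum)
    (by
      intro n hn
      have h := star17_translate a n (by omega) (converges_translate (by omega)) (converges_translate (by omega))
        (converges_translate (by omega))
      rw [starKappa_translate a n (by norm_num) (by norm_num), fanCoeff_seven_translate, fanCoeff_one_translate] at h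
      push_cast at h
      simp only [Fin.sum_univ_three, Matrix.cons_val_zero, Matrix.cons_val_one, Matrix.head_cons, Matrix.cons_val_two,
        Matrix.tail_cons]
      linear_combination h)
  unfold ThreeTermRel
  simp only [Fin.sum_univ_three, Matrix.cons_val_zero, Matrix.cons_val_one, Matrix.head_cons, Matrix.cons_val_two,
    Matrix.tail_cons] at key
  simp only [starKappa, fanCoeff, chiOf, nonEdgePartners, List.map, List.prod_cons, List.prod_nil, or_self, ↓reduceIte,
    Nat.reduceEqDiff]
  push_cast
  linear_combination key

/-- **Cellular STAR at the pair `(2,7)`, every convergent configuration.** [folklore] -/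
theorem cellStar_wide_27 (a : Fin 8 → ℤ) (hc0 : Converges a) (hc1 : Converges (a + slotDown 7))
    (hc2 : Converges (a + slotDown 2)) :
    ThreeTermRel (starKappa (bOfA a) 2 7) (-fanCoeff (bOfA a) 7) (fanCoeff (bOfA a) 2) a (a + slotDown 7) (a + slotDown 2) := by
  have key := threeTerm_of_translates ![a, a + slotDown 7, a + slotDown 2]
    (by intro m; fin_cases m <;> assumption)
    ![0, -1, 1]
    ![((bOfA a 2 : ℝ) - bOfA a 7),
      -((2 * (bOfA a 0 : ℝ) + 2 - 2 * bOfA a 7 - bOfA a 1 - bOfA a 2)),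
      ((bOfA a 2 : ℝ) + ((bOfA a 0 : ℝ) + 1 - bOfA a 2 - bOfA a 7))]
    ![((bOfA a 2 : ℝ) - bOfA a 7) * ((bOfA a 0 : ℝ) + 1 - bOfA a 2 - bOfA a 7),
      -(((bOfA a 0 : ℝ) + 1 - bOfA a 7 - bOfA a 1) * ((bOfA a 0 : ℝ) + 1 - bOfA a 7 - bOfA a 2)),
      (bOfA a 2 : ℝ) * ((bOfA a 0 : ℝ) + 1 - bOfA a 2 - bOfA a 7)]
    (N₀ := 40 * (∑ j : Fin 8, (a j).natAbs) + 8 + ((hList a).map Int.natAbs).sum +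
      ((hList (a + slotDown 7)).map Int.natAbs).sum + ((hList (a + slotDown 2)).map Int.natAbs).sum)
    (by
      intro n hn
      have h := star27_translate a n (by omega) (converges_translate (by omega)) (converges_translate (by omega))
        (converges_translate (by omega))
      rw [starKappa_translate a n (by norm_num) (by norm_num), fanCoeff_seven_translate, fanCoeff_two_translate] at h
      push_cast at h
      simp only [Fin.sum_univ_three, Matrix.cons_val_zero, Matrix.cons_val_one, Matrix.head_cons, Matrix.cons_val_two,
        Matrix.tail_cons]
      linear_combination h)
  unfold ThreeTermRel
  simp only [Fin.sum_univ_three, Matrix.cons_val_zero, Matrix.cons_val_one, Matrix.head_cons, Matrix.cons_val_two,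
    Matrix.tail_cons] at key
  simp only [starKappa, fanCoeff, chiOf, nonEdgePartners, List.map, List.prod_cons, List.prod_nil, or_self, or_false,
    ↓reduceIte, Nat.reduceEqDiff]
  push_cast
  linear_combination key

/-- **Cellular STAR at the pair `(1,2)`, every convergent configuration.** [folklore] -/
theorem cellStar_wide_12 (a : Fin 8 → ℤ) (hc0 : Converges a) (hc1 : Converges (a + slotDown 2))
    (hc2 : Converges (a + slotDown 1)) :
    ThreeTermRel (starKappa (bOfA a) 1 2) (-fanCoeff (bOfA a) 2) (fanCoeff (bOfA a) 1) a (a + slotDown 2) (a + slotDown 1) := by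
  have key := threeTerm_of_translates ![a, a + slotDown 2, a + slotDown 1]
    (by intro m; fin_cases m <;> assumption)
    ![0, -1, 1]
    ![((bOfA a 1 : ℝ) - bOfA a 2),
      -((bOfA a 2 : ℝ) + ((bOfA a 0 : ℝ) + 1 - bOfA a 2 - bOfA a 7)),
      (2 * (bOfA a 0 : ℝ) + 2 - 2 * bOfA a 1 - bOfA a 6 - bOfA a 7)]
    ![((bOfA a 1 : ℝ) - bOfA a 2) * ((bOfA a 0 : ℝ) + 1 - bOfA a 1 - bOfA a 2),
      -((bOfA a 2 : ℝ) * ((bOfA a 0 : ℝ) + 1 - bOfA a 2 - bOfA a 7)),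
      ((bOfA a 0 : ℝ) + 1 - bOfA a 1 - bOfA a 6) * ((bOfA a 0 : ℝ) + 1 - bOfA a 1 - bOfA a 7)]
    (N₀ := 40 * (∑ j : Fin 8, (a j).natAbs) + 8 + ((hList a).map Int.natAbs).sum +
      ((hList (a + slotDown 2)).map Int.natAbs).sum + ((hList (a + slotDown 1)).map Int.natAbs).sum)
    (by
      intro n hn
      have h := star12_translate a n (by omega) (converges_translate (by omega)) (converges_translate (by omega))
        (converges_translate (by omega))
      rw [starKappa_translate a n (by norm_num) (by norm_num), fanCoeff_two_translate, fanCoeff_one_translate] at h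
      push_cast at h
      simp only [Fin.sum_univ_three, Matrix.cons_val_zero, Matrix.cons_val_one, Matrix.head_cons, Matrix.cons_val_two,
        Matrix.tail_cons]
      linear_combination h)
  unfold ThreeTermRel
  simp only [Fin.sum_univ_three, Matrix.cons_val_zero, Matrix.cons_val_one, Matrix.head_cons, Matrix.cons_val_two,
    Matrix.tail_cons] at key
  simp only [starKappa, fanCoeff, chiOf, nonEdgePartners, List.map, List.prod_cons, List.prod_nil, or_self, or_false,
    ↓reduceIte, Nat.reduceEqDiff]
  push_cast
  linear_combination key

/-- The pair `(7,1)` (swapped orientation of `cellStar_wide_17`). [folklore] -/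
theorem cellStar_wide_71 (a : Fin 8 → ℤ) (hc0 : Converges a) (hc1 : Converges (a + slotDown 1))
    (hc2 : Converges (a + slotDown 7)) :
    ThreeTermRel (starKappa (bOfA a) 7 1) (-fanCoeff (bOfA a) 1) (fanCoeff (bOfA a) 7) a (a + slotDown 1) (a + slotDown 7) :=
  cellStar_swap (cellStar_wide_17 a hc0 hc2 hc1)

/-- The pair `(7,2)` (swapped orientation of `cellStar_wide_27`). [folklore] -/
theorem cellStar_wide_72 (a : Fin 8 → ℤ) (hc0 : Converges a) (hc1 : Converges (a + slotDown 2))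
    (hc2 : Converges (a + slotDown 7)) :
    ThreeTermRel (starKappa (bOfA a) 7 2) (-fanCoeff (bOfA a) 2) (fanCoeff (bOfA a) 7) a (a + slotDown 2) (a + slotDown 7) :=
  cellStar_swap (cellStar_wide_27 a hc0 hc2 hc1)

/-- The pair `(2,1)` (swapped orientation of `cellStar_wide_12`). [folklore] -/
theorem cellStar_wide_21 (a : Fin 8 → ℤ) (hc0 : Converges a) (hc1 : Converges (a + slotDown 1))
    (hc2 : Converges (a + slotDown 2)) :
    ThreeTermRel (starKappa (bOfA a) 2 1) (-fanCoeff (bOfA a) 1) (fanCoeff (bOfA a) 2) a (a + slotDown 1) (a + slotDown 2) :=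
  cellStar_swap (cellStar_wide_12 a hc0 hc2 hc1)

end Summit.KontsevichZagierPeriods.Zeta5Search.CellStarWide

end
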